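import Summits.BirchSwinnertonDyer.BirchSwinnertonDyer.Theorems.ManinLocalTwoThreeCubeStepPair
import Summits.BirchSwinnertonDyer.BirchSwinnertonDyer.Theorems.ManinLocalTwoThreeTwoShiftLaws
import HarnessLib

/-!
# The prime-generic transfer step, I: `SL(2, ℤ)` acting on `P¹(𝔽_p)` and the three subgroups of `Γ₀(M)`, `p ∤ M`
# (route `ManinLocalTwoThree`, cell bsd-f2-manin; cruxes C2 `ManinOddAtFour` stmt-BirchSwinnertonDyer-22967 / C3 stmt-…-22968; LEAD seat
# p1 gen 12; the «odd → p·odd» step of the LEAD's prime-generic shift-equaliser conjecture, HOME/p1/CENSUS-shift-equaliser-p1-g11.md)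

The `p`-GENERIC form of p3's `…CubeTransfer.lean` (`p = 3`) and of the seat's `…TwoShiftTransfer.lean` (`p = 2`): for ANY prime `p`
and a level `M` prime to `p`, the subgroups `B = Γ₀(pM)` and `A = Γ₀(M) ∩ Γ⁰(p)` of `G = Γ₀(M)` are the stabilisers of `∞` and `0`
in the action of `G` on `P¹(𝔽_p)` (`p + 1` points) through `SL₂(𝔽_p)`; the index `[G : Stab 0] = p + 1 ≡ 1 (mod p)` is what makes
the TRANSFER (p3's abstract `CubeStep.transferSum`) descend `p`-shift eigencharacters from `Γ₀(pM)` to `Γ₀(M)` (sibling files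
`…PShiftTransferPair.lean`, `…PShiftTransferStep.lean`; for `p ≥ 5` the cocycle bookkeeping of the `p = 2, 3` files is replaced there by
the vanishing of `Hom(B(𝔽_p)/±1, K)` for `p`-torsion `K`).  Here:
* §1 `P¹(𝔽_p) = Option (ZMod p)` (`none = ∞ = [1:0]`, `some j = [j:1]`), the action `act` by reduction mod `p` (`act_one`, `act_mul`),
  `act γ ∞ = ∞ ↔ p ∣ c`, `act γ 0 = 0 ↔ p ∣ b`, elements `≡ (a 0; 0 a)` act trivially, `T^k` translates;
* §2 the subgroups `stabInf M = Γ₀(pM)`, `stabZero M`, `kerAct M` of `Γ₀(M)`, entrywise descriptions, the Bezout pair for `(p, M)`.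
Vocabulary: p3's `TwoShift.IsAdd / IsDiamond / RestrictsFrom` (any `K`).  Nothing about BSD, Manin's conjecture, C2/C3 or the equaliser
laws is asserted here.  References: MEMO-es §37.9 (the `p = 3` original); K. S. Brown, *Cohomology of Groups*, III.9
[cite: DarmonDiamondTaylor1995, Lemma 4.28 (p. 135) (shape: degeneracy maps on `Γ₀`)].
-/

set_option autoImplicit false
set_option linter.dupNamespace false

open scoped MatrixGroups

open CongruenceSubgroup Matrix.SpecialLinearGroup
  Summit.BirchSwinnertonDyer.Rank1Residual.ManinAdditive.NineShiftEqualiser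

namespace Summit.BirchSwinnertonDyer.BirchSwinnertonDyer.Theorems.ManinLocalTwoThree

namespace PShiftTransfer

variable {p : ℕ} [Fact p.Prime]

/-! ### §1. `P¹(𝔽_p)` as `Option (ZMod p)` and the action of `SL(2, ℤ)` -/

section ProjectiveLine

/-- Homogeneous coordinates of a point of `P¹(𝔽_p)`: `∞ = none ↦ (1, 0)`, `some j ↦ (j, 1)`. [folklore] -/
def vec : Option (ZMod p) → ZMod p × ZMod p
  | none => (1, 0)
  | some j => (j, 1)

/-- The point of `P¹(𝔽_p)` with homogeneous coordinates `(u, v) ≠ (0, 0)`. [folklore] -/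
noncomputable def label (u v : ZMod p) : Option (ZMod p) := if v = 0 then none else some (u * v⁻¹)

/-- `label ∘ vec = id`. [folklore] -/
theorem label_vec (ℓ : Option (ZMod p)) : label (vec ℓ).1 (vec ℓ).2 = ℓ := by
  rcases ℓ with _ | j
  · simp [vec, label]
  · simp [vec, label]

/-- `vec ∘ label` rescales by a unit. [folklore] -/
theorem vec_label (u v : ZMod p) (h : ¬(u = 0 ∧ v = 0)) :
    ∃ l : ZMod p, l ≠ 0 ∧ vec (label u v) = (l * u, l * v) := by
  by_cases hv : v = 0
  · have hu : u ≠ 0 := fun hu => h ⟨hu, hv⟩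
    refine ⟨u⁻¹, inv_ne_zero hu, ?_⟩
    simp [label, vec, hv, inv_mul_cancel₀ hu]
  · refine ⟨v⁻¹, inv_ne_zero hv, ?_⟩
    simp [label, vec, hv, mul_comm]

/-- `label` is invariant under rescaling by a unit. [folklore] -/
theorem label_smul (l u v : ZMod p) (hl : l ≠ 0) : label (l * u) (l * v) = label u v := by
  by_cases hv : v = 0
  · simp [label, hv]
  · have hlv : l * v ≠ 0 := mul_ne_zero hl hv
    simp only [label, if_neg hv, if_neg hlv, Option.some.injEq]
    rw [mul_inv, mul_mul_mul_comm, mul_inv_cancel₀ hl, one_mul]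

/-- A matrix of determinant `1` over `𝔽_p` does not kill a nonzero vector. [folklore] -/
theorem apply_ne_zero (a b c d u v : ZMod p) (hdet : a * d - b * c = 1) (h : ¬(u = 0 ∧ v = 0)) :
    ¬(a * u + b * v = 0 ∧ c * u + d * v = 0) := by
  rintro ⟨h1, h2⟩
  apply h
  constructor
  · linear_combination d * h1 - b * h2 - u * hdet
  · linear_combination a * h2 - c * h1 - v * hdet

/-- `vec ℓ ≠ 0`. [folklore] -/
theorem vec_ne_zero (ℓ : Option (ZMod p)) : ¬((vec ℓ).1 = 0 ∧ (vec ℓ).2 = 0) := by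
  rcases ℓ with _ | j <;> simp [vec]

/-- The mod-`p` reduction of an entry of `γ ∈ SL(2, ℤ)`. [folklore] -/
abbrev ent (γ : SL(2, ℤ)) (i j : Fin 2) : ZMod p := ((γ i j : ℤ) : ZMod p)

/-- `ent γ i j = 0 ↔ p ∣ γ i j`. [folklore] -/
theorem ent_eq_zero_iff (γ : SL(2, ℤ)) (i j : Fin 2) : ent (p := p) γ i j = 0 ↔ (p : ℤ) ∣ (γ i j : ℤ) :=
  ZMod.intCast_zmod_eq_zero_iff_dvd (γ i j : ℤ) p

/-- The determinant of `γ ∈ SL(2, ℤ)` mod `p`. [folklore] -/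
theorem det_ent (γ : SL(2, ℤ)) : ent (p := p) γ 0 0 * ent γ 1 1 - ent γ 0 1 * ent γ 1 0 = 1 := by
  have h := Matrix.det_fin_two (γ : Matrix (Fin 2) (Fin 2) ℤ)
  rw [γ.2] at h
  have h' := congrArg (Int.cast : ℤ → ZMod p) h
  push_cast at h'
  simpa [ent] using h'.symm

/-- **The action of `SL(2, ℤ)` on `P¹(𝔽_p)`** (through reduction mod `p`, on column vectors). [folklore] -/
noncomputable def act (γ : SL(2, ℤ)) (ℓ : Option (ZMod p)) : Option (ZMod p) :=
  label (ent γ 0 0 * (vec ℓ).1 + ent γ 0 1 * (vec ℓ).2) (ent γ 1 0 * (vec ℓ).1 + ent γ 1 1 * (vec ℓ).2)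

/-- `1` acts trivially. [folklore] -/
theorem act_one (ℓ : Option (ZMod p)) : act 1 ℓ = ℓ := by
  simp [act, ent, label_vec]

/-- **`act` is an action**: `(γδ)·ℓ = γ·(δ·ℓ)`. [folklore] -/
theorem act_mul (γ δ : SL(2, ℤ)) (ℓ : Option (ZMod p)) : act (γ * δ) ℓ = act γ (act δ ℓ) := by
  set u := (vec ℓ).1 with hu
  set v := (vec ℓ).2 with hv
  set q := ent (p := p) δ 0 0 * u + ent δ 0 1 * v with hq
  set r := ent (p := p) δ 1 0 * u + ent δ 1 1 * v with hr
  have hqr : ¬(q = 0 ∧ r = 0) := apply_ne_zero _ _ _ _ u v (det_ent δ) (vec_ne_zero ℓ)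
  obtain ⟨l, hl, hvl⟩ := vec_label q r hqr
  have hR : act γ (act δ ℓ) = label (ent γ 0 0 * q + ent γ 0 1 * r) (ent γ 1 0 * q + ent γ 1 1 * r) := by
    rw [show act δ ℓ = label q r from rfl, act, hvl]
    dsimp only
    rw [show ent (p := p) γ 0 0 * (l * q) + ent γ 0 1 * (l * r) = l * (ent γ 0 0 * q + ent γ 0 1 * r) by ring,
      show ent (p := p) γ 1 0 * (l * q) + ent γ 1 1 * (l * r) = l * (ent γ 1 0 * q + ent γ 1 1 * r) by ring,
      label_smul _ _ _ hl]
  have hent : ∀ i j : Fin 2, ent (p := p) (γ * δ) i j = ent γ i 0 * ent δ 0 j + ent γ i 1 * ent δ 1 j := by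
    intro i j
    simp [ent, Matrix.SpecialLinearGroup.coe_mul, Matrix.mul_apply, Fin.sum_univ_two]
  rw [hR, act, hent, hent, hent, hent]
  congr 1
  · rw [hq, hr]; ring
  · rw [hq, hr]; ring

/-- `γ⁻¹·(γ·ℓ) = ℓ`. [folklore] -/
theorem act_inv_act (γ : SL(2, ℤ)) (ℓ : Option (ZMod p)) : act γ⁻¹ (act γ ℓ) = ℓ := by
  rw [← act_mul, inv_mul_cancel, act_one]

/-- `γ·ℓ` is injective in `ℓ`. [folklore] -/
theorem act_injective (γ : SL(2, ℤ)) : Function.Injective (act (p := p) γ) := fun x y h => by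
  simpa [act_inv_act] using congrArg (act γ⁻¹) h

/-- `γ·∞` in coordinates. [folklore] -/
theorem act_none (γ : SL(2, ℤ)) : act (p := p) γ none = label (ent γ 0 0) (ent γ 1 0) := by
  simp [act, vec]

/-- `γ·0` in coordinates. [folklore] -/
theorem act_some_zero (γ : SL(2, ℤ)) : act (p := p) γ (some 0) = label (ent γ 0 1) (ent γ 1 1) := by
  simp [act, vec]

/-- **`B = Stab(∞)`**: `γ·∞ = ∞ ↔ p ∣ c`. [folklore] -/
theorem act_none_eq_none_iff (γ : SL(2, ℤ)) : act (p := p) γ none = none ↔ (p : ℤ) ∣ (γ 1 0 : ℤ) := by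
  rw [act_none, label, ← ent_eq_zero_iff]
  constructor
  · intro h
    by_contra hc
    rw [if_neg hc] at h
    exact Option.some_ne_none _ h
  · intro h
    rw [if_pos h]

/-- Auxiliary: for `ad − bc = 1` in `𝔽_p`, `label b d = 0 ↔ b = 0`. [folklore] -/
theorem label_eq_some_zero_iff (a b c d : ZMod p) (hdet : a * d - b * c = 1) : label b d = some 0 ↔ b = 0 := by
  by_cases hd : d = 0
  · rw [label, if_pos hd]
    constructor
    · intro h; exact absurd h (Option.some_ne_none 0).symm
    · intro hb
      rw [hb, hd, mul_zero, zero_mul, sub_zero] at hdet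
      exact absurd hdet zero_ne_one
  · rw [label, if_neg hd, Option.some.injEq, mul_eq_zero, or_iff_left (inv_ne_zero hd)]

/-- **`A = Stab(0)`**: `γ·0 = 0 ↔ p ∣ b`. [folklore] -/
theorem act_some_zero_eq_iff (γ : SL(2, ℤ)) : act (p := p) γ (some 0) = some 0 ↔ (p : ℤ) ∣ (γ 0 1 : ℤ) := by
  rw [act_some_zero, label_eq_some_zero_iff _ _ _ _ (det_ent γ), ← ent_eq_zero_iff]

/-- **The scalar elements act trivially**: `b ≡ c ≡ 0`, `a ≡ d (mod p)` implies `γ` acts trivially. [folklore] -/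
theorem act_eq_self (γ : SL(2, ℤ)) (hb : (p : ℤ) ∣ (γ 0 1 : ℤ)) (hc : (p : ℤ) ∣ (γ 1 0 : ℤ))
    (had : (p : ℤ) ∣ (γ 0 0 : ℤ) - γ 1 1) (ℓ : Option (ZMod p)) : act γ ℓ = ℓ := by
  have hb' : ent (p := p) γ 0 1 = 0 := (ent_eq_zero_iff γ 0 1).mpr hb
  have hc' : ent (p := p) γ 1 0 = 0 := (ent_eq_zero_iff γ 1 0).mpr hc
  have had' : ent (p := p) γ 0 0 = ent γ 1 1 := by
    have := (ZMod.intCast_zmod_eq_zero_iff_dvd _ p).mpr had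
    push_cast at this
    exact sub_eq_zero.mp this
  have hdet := det_ent (p := p) γ
  rw [hb', hc', zero_mul, sub_zero] at hdet
  have ha : ent (p := p) γ 0 0 ≠ 0 := fun h => by rw [h, zero_mul] at hdet; exact zero_ne_one hdet
  rw [act, hb', hc', ← had', zero_mul, add_zero, zero_mul, zero_add, label_smul _ _ _ ha, label_vec]

/-- **Affine maps**: an element of `Stab(∞)` (`p ∣ c`) acts on the affine line by `u ↦ (a u + b)/d`. [folklore] -/
theorem act_some_of_dvd (γ : SL(2, ℤ)) (hc : (p : ℤ) ∣ (γ 1 0 : ℤ)) (u : ZMod p) :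
    act γ (some u) = some ((ent γ 0 0 * u + ent γ 0 1) * (ent γ 1 1)⁻¹) := by
  have hc' : ent (p := p) γ 1 0 = 0 := (ent_eq_zero_iff γ 1 0).mpr hc
  have hdet := det_ent (p := p) γ
  rw [hc', mul_zero, sub_zero] at hdet
  have hd : ent (p := p) γ 1 1 ≠ 0 := fun h => by rw [h, mul_zero] at hdet; exact zero_ne_one hdet
  simp only [act, vec, hc', zero_mul, zero_add, mul_one, label, if_neg hd]

/-- Every `γ` maps SOME finite point to a finite point. [folklore] -/
theorem exists_act_some_eq_some (γ : SL(2, ℤ)) : ∃ u v : ZMod p, act γ (some u) = some v := by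
  by_cases h : act (p := p) γ (some 0) = none
  · have h1 : act (p := p) γ (some 1) ≠ none := fun h1 => by
      have := act_injective γ (h.trans h1.symm)
      exact absurd (Option.some_injective _ this) zero_ne_one
    obtain ⟨v, hv⟩ := Option.ne_none_iff_exists'.mp h1
    exact ⟨1, v, hv⟩
  · obtain ⟨v, hv⟩ := Option.ne_none_iff_exists'.mp h
    exact ⟨0, v, hv⟩

variable {M : ℕ}

/-- The action of an explicit matrix `g0Of a b c d ∈ Γ₀(M)`. [folklore] -/
theorem act_g0Of (a b c d : ℤ) (h : a * d - b * c = 1) (hc : (M : ℤ) ∣ c) (ℓ : Option (ZMod p)) :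
    act ((g0Of a b c d h hc : Gamma0 M) : SL(2, ℤ)) ℓ =
      label ((a : ZMod p) * (vec ℓ).1 + (b : ZMod p) * (vec ℓ).2)
        ((c : ZMod p) * (vec ℓ).1 + (d : ZMod p) * (vec ℓ).2) := rfl

/-- `T^k` fixes `∞`. [folklore] -/
theorem act_Tpow_none (k : ℤ) : act (p := p) ((ThreeShiftDescent.Tpow M k : Gamma0 M) : SL(2, ℤ)) none = none := by
  simp [ThreeShiftDescent.Tpow, act_g0Of, vec, label]

/-- `T^k` translates the affine line by `k`. [folklore] -/
theorem act_Tpow_some (k : ℤ) (u : ZMod p) :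
    act ((ThreeShiftDescent.Tpow M k : Gamma0 M) : SL(2, ℤ)) (some u) = some (u + (k : ZMod p)) := by
  simp [ThreeShiftDescent.Tpow, act_g0Of, vec, label]

end ProjectiveLine

/-! ### §2. The three subgroups of `Γ₀(M)` and their entries -/

section Subgroups

open ThreeShiftDescent

variable (p) (M : ℕ)

/-- `Stab(∞) = {γ ∈ Γ₀(M) : p ∣ c} = Γ₀(pM)` (for `p ∤ M`). [folklore] -/
def stabInf : Subgroup (Gamma0 M) where
  carrier := {γ | act (p := p) (γ : SL(2, ℤ)) none = none}
  mul_mem' := by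
    intro x y hx hy
    simp only [Set.mem_setOf_eq, Subgroup.coe_mul, act_mul] at *
    rw [hy, hx]
  one_mem' := by simp [act_one]
  inv_mem' := by
    intro x hx
    simp only [Set.mem_setOf_eq, Subgroup.coe_inv] at *
    conv_lhs => rw [← hx]
    rw [act_inv_act]

/-- `Stab(0) = {γ ∈ Γ₀(M) : p ∣ b} = Γ₀(M) ∩ Γ⁰(p)`. [folklore] -/
def stabZero : Subgroup (Gamma0 M) where
  carrier := {γ | act (p := p) (γ : SL(2, ℤ)) (some 0) = some 0}
  mul_mem' := by
    intro x y hx hy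
    simp only [Set.mem_setOf_eq, Subgroup.coe_mul, act_mul] at *
    rw [hy, hx]
  one_mem' := by simp [act_one]
  inv_mem' := by
    intro x hx
    simp only [Set.mem_setOf_eq, Subgroup.coe_inv] at *
    conv_lhs => rw [← hx]
    rw [act_inv_act]

/-- The kernel of the action on `P¹(𝔽_p)`: `{γ ∈ Γ₀(M) : γ ≡ ±I (mod p)}`. [folklore] -/
def kerAct : Subgroup (Gamma0 M) where
  carrier := {γ | ∀ ℓ, act (p := p) (γ : SL(2, ℤ)) ℓ = ℓ}
  mul_mem' := by
    intro x y hx hy ℓ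
    simp only [Set.mem_setOf_eq] at hx hy
    rw [Subgroup.coe_mul, act_mul, hy, hx]
  one_mem' := fun ℓ => by simp [act_one]
  inv_mem' := by
    intro x hx ℓ
    simp only [Set.mem_setOf_eq] at hx
    conv_lhs => rw [← hx ℓ]
    rw [Subgroup.coe_inv, act_inv_act]

variable {p M}

/-- Membership in `stabInf`. [folklore] -/
theorem mem_stabInf {γ : Gamma0 M} : γ ∈ stabInf p M ↔ act (p := p) (γ : SL(2, ℤ)) none = none := Iff.rfl

/-- Membership in `stabZero`. [folklore] -/
theorem mem_stabZero {γ : Gamma0 M} : γ ∈ stabZero p M ↔ act (p := p) (γ : SL(2, ℤ)) (some 0) = some 0 :=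
  Iff.rfl

/-- Membership in `kerAct`. [folklore] -/
theorem mem_kerAct {γ : Gamma0 M} : γ ∈ kerAct p M ↔ ∀ ℓ, act (p := p) (γ : SL(2, ℤ)) ℓ = ℓ := Iff.rfl

/-- `kerAct` from entries: `p ∣ b`, `p ∣ c`, `p ∣ a − d`. [folklore] -/
theorem mem_kerAct_of_entries {γ : Gamma0 M} (hb : (p : ℤ) ∣ ((γ : SL(2, ℤ)) 0 1 : ℤ))
    (hc : (p : ℤ) ∣ ((γ : SL(2, ℤ)) 1 0 : ℤ)) (had : (p : ℤ) ∣ ((γ : SL(2, ℤ)) 0 0 : ℤ) - (γ : SL(2, ℤ)) 1 1) :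
    γ ∈ kerAct p M := fun ℓ => act_eq_self _ hb hc had ℓ

/-- `kerAct ≤ stabInf`. [folklore] -/
theorem stabInf_of_kerAct {γ : Gamma0 M} (h : γ ∈ kerAct p M) : γ ∈ stabInf p M := h none

/-- `kerAct ≤ stabZero`. [folklore] -/
theorem stabZero_of_kerAct {γ : Gamma0 M} (h : γ ∈ kerAct p M) : γ ∈ stabZero p M := h (some 0)

/-- `kerAct` is normal in `Γ₀(M)`. [folklore] -/
theorem kerAct_conj_mem (g : Gamma0 M) {x : Gamma0 M} (hx : x ∈ kerAct p M) : g * x * g⁻¹ ∈ kerAct p M := by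
  intro ℓ
  rw [Subgroup.coe_mul, Subgroup.coe_mul, act_mul, act_mul, hx, ← act_mul, Subgroup.coe_inv, mul_inv_cancel,
    act_one]

/-- `kerAct` is normal in `Γ₀(M)` (conjugation the other way). [folklore] -/
theorem kerAct_inv_conj_mem (g : Gamma0 M) {x : Gamma0 M} (hx : x ∈ kerAct p M) : g⁻¹ * x * g ∈ kerAct p M := by
  simpa using kerAct_conj_mem g⁻¹ hx

/-- **The Bezout pair**: for `p ∤ M` there are `δ, k` with `pδ + kM = 1`. [folklore] -/
theorem exists_bezout (hpM : ¬ p ∣ M) : ∃ δ k : ℤ, (p : ℤ) * δ + k * M = 1 := by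
  have hcop : IsCoprime (p : ℤ) (M : ℤ) :=
    Nat.isCoprime_iff_coprime.mpr ((Nat.Prime.coprime_iff_not_dvd (Fact.out)).mpr hpM)
  obtain ⟨u, v, huv⟩ := hcop
  exact ⟨u, v, by linear_combination huv⟩

/-- `p ∣ c` and `M ∣ c` give `pM ∣ c` when `p ∤ M`. [folklore] -/
theorem p_mul_dvd (hpM : ¬ p ∣ M) {c : ℤ} (hp : (p : ℤ) ∣ c) (hM : (M : ℤ) ∣ c) : ((p * M : ℕ) : ℤ) ∣ c := by
  have hcop : IsCoprime (p : ℤ) (M : ℤ) :=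
    Nat.isCoprime_iff_coprime.mpr ((Nat.Prime.coprime_iff_not_dvd (Fact.out)).mpr hpM)
  push_cast
  exact hcop.mul_dvd hp hM

/-- `stabInf` by entries: `pM ∣ c`. [folklore] -/
theorem mem_stabInf_iff (hpM : ¬ p ∣ M) {γ : Gamma0 M} :
    γ ∈ stabInf p M ↔ ((p * M : ℕ) : ℤ) ∣ ((γ : SL(2, ℤ)) 1 0 : ℤ) := by
  rw [mem_stabInf, act_none_eq_none_iff]
  constructor
  · intro h
    exact p_mul_dvd hpM h ((ZMod.intCast_zmod_eq_zero_iff_dvd _ _).mp (Gamma0_mem.mp γ.2))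
  · intro h
    exact (dvd_mul_right (p : ℤ) (M : ℤ)).trans (by exact_mod_cast h)

/-- `stabZero` by entries: `p ∣ b`. [folklore] -/
theorem mem_stabZero_iff {γ : Gamma0 M} : γ ∈ stabZero p M ↔ (p : ℤ) ∣ ((γ : SL(2, ℤ)) 0 1 : ℤ) := by
  rw [mem_stabZero, act_some_zero_eq_iff]

/-- An element of `stabZero` is `(a, p b; c, d)`. [folklore] -/
theorem exists_eq_of_mem_stabZero {x : Gamma0 M} (hx : x ∈ stabZero p M) :
    ∃ (a b c d : ℤ) (h : a * d - (p * b) * c = 1) (hc : (M : ℤ) ∣ c), x = g0Of a (p * b) c d h hc := by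
  obtain ⟨b, hb⟩ := mem_stabZero_iff.mp hx
  have hdet := gamma0_det_entries x
  rw [hb] at hdet
  refine ⟨_, b, _, _, hdet, ((ZMod.intCast_zmod_eq_zero_iff_dvd _ _).mp (Gamma0_mem.mp x.2)), ?_⟩
  calc x = g0Of ((x : SL(2, ℤ)) 0 0) ((x : SL(2, ℤ)) 0 1) ((x : SL(2, ℤ)) 1 0) ((x : SL(2, ℤ)) 1 1)
        (gamma0_det_entries x) ((ZMod.intCast_zmod_eq_zero_iff_dvd _ _).mp (Gamma0_mem.mp x.2)) :=
      (g0Of_entries x (gamma0_det_entries x) ((ZMod.intCast_zmod_eq_zero_iff_dvd _ _).mp (Gamma0_mem.mp x.2))).symm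
    _ = _ := g0Of_congr rfl hb rfl rfl _ _ _ _

/-- An element of `stabInf` is `(a, b; c, d)` with `pM ∣ c`. [folklore] -/
theorem exists_eq_of_mem_stabInf (hpM : ¬ p ∣ M) {x : Gamma0 M} (hx : x ∈ stabInf p M) :
    ∃ (a b c d : ℤ) (h : a * d - b * c = 1) (hc : (M : ℤ) ∣ c),
      ((p * M : ℕ) : ℤ) ∣ c ∧ x = g0Of a b c d h hc :=
  ⟨_, _, _, _, gamma0_det_entries x, ((ZMod.intCast_zmod_eq_zero_iff_dvd _ _).mp (Gamma0_mem.mp x.2)),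
    (mem_stabInf_iff hpM).mp hx,
    (g0Of_entries x (gamma0_det_entries x) ((ZMod.intCast_zmod_eq_zero_iff_dvd _ _).mp (Gamma0_mem.mp x.2))).symm⟩

/-- `g0Of a (p b) c d ∈ stabZero`. [folklore] -/
theorem g0Of_mem_stabZero (a b c d : ℤ) (h : a * d - (p * b) * c = 1) (hc : (M : ℤ) ∣ c) :
    (g0Of a (p * b) c d h hc : Gamma0 M) ∈ stabZero p M :=
  mem_stabZero_iff.mpr ⟨b, rfl⟩

/-- `g0Of a b c d ∈ stabInf` when `pM ∣ c`. [folklore] -/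
theorem g0Of_mem_stabInf (hpM : ¬ p ∣ M) (a b c d : ℤ) (h : a * d - b * c = 1) (hc : (M : ℤ) ∣ c)
    (hcp : ((p * M : ℕ) : ℤ) ∣ c) : (g0Of a b c d h hc : Gamma0 M) ∈ stabInf p M :=
  (mem_stabInf_iff hpM).mpr hcp

/-- `T^k ∈ stabInf`. [folklore] -/
theorem Tpow_mem_stabInf (k : ℤ) : (Tpow M k : Gamma0 M) ∈ stabInf p M := act_Tpow_none k

omit [Fact p.Prime] in
/-- `pM ∣ pc` from `M ∣ c`. [folklore] -/
theorem dvd_p_mul' {c : ℤ} (hc : (M : ℤ) ∣ c) : ((p * M : ℕ) : ℤ) ∣ p * c := by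
  obtain ⟨k, hk⟩ := hc
  exact ⟨k, by rw [hk]; push_cast; ring⟩

end Subgroups

end PShiftTransfer

end Summit.BirchSwinnertonDyer.BirchSwinnertonDyer.Theorems.ManinLocalTwoThree
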